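/-
Copyright (c) 2026 the pub-hodgecm-mathlib formalisation cell (harness21).  Prover seat hodgecm-mathlib-LH4-p11 (g8), req620 Track A «(D-RAM) FOUR-FRAME» squad, helper lane on
h413 = stmt-HodgeConjecture-24833 (count-neutral).  Dealer∕pen LH4-plan (g13) WORD #114 «THE χ-FLIP UNIT PER SPECIFIC CELL»; SIG-beta2H-flipUnits v1 (8372ea68).  2026-09-04.
-/
import Summits.HodgeConjecture.HodgeConjecture.Theorems.F0P3cDyRamConeCellFlipBalance      -- ★ p860839 (LH4-p09 (g9)) (β₂-H) ENGINE PART 2: flip ∕ fibre balances; brings ★ `ConeWeightHalfSplit` (flip units), ★ DEFS `ToricCensusDefs`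
import Literature.NumberTheory.LocalFields.WildQuadraticDatumNormSignConductor               -- ★ deep norms `exists_mul_map_eq_of_fixed_of_v_sub_one_le_pred`
import Literature.NumberTheory.LocalFields.WildQuadraticDatumTraceBound                       -- ★ `trace_bound_of_isRamifiedQuadraticDatum`
import HarnessLib

/-!
# Crux `H413`, line LH4 «(D-RAM) FOUR-FRAME» — STAGE-1b, the (β₂) road, brick (β₂-H): THE χ-FLIP UNIT OF A SPECIFIC CONE CELL EXISTS, and the cell is balanced GIVEN THE FACE

Cell `hodgecm-mathlib` (D-0151), FLOOR 0, crux item H413 = `stmt-HodgeConjecture-24833`, route `HCCMUnconditional`; squad F0∕P3c∕LH4.  THEOREMS ONLY (no `def`, no instance, no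
notation, no `sorry`, default heartbeats); ★-only imports; lane `--supports stmt-HodgeConjecture-24833 --as helper` (count-neutral); states NO law; (β₂) stays a HYPOTHESIS.
THE MATHEMATICS (LH4-p09 (g9) MECH-beta2H v1 c3af1df2 (M1)–(M4); ★ p860839).  ★ p860839 proves that a SPECIFIC cone cell is balanced half∕half for any label reversed by a
cell-preserving symmetry; this file supplies the SYMMETRY and composes.  §A TUBE cells (`b ≥ d`, E-letters of ★ T2b: the glue fibre `Sol_{2b}(r) ⊂ 𝒪∕𝓂^{2b}`): for every
`σ`-fixed `η` with `|η − 1| ≤ |ϖ|^{2b}` there is a unit `w` with `wσw = η` (★ deep norms, `2b ≥ 2d − 1`) — `x ↦ x·w` preserves the fibre —, and if `|η − 1| = |ϖ|^{2b}` EXACTLY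
then `w` is NOT in the class `E¹·(1 + 𝓂^{2b})` of the exact norm-one units (`N(z(1+x)) − 1 = Tr x + N x` lies one digit deeper, ★ trace bound under `|2| < 1`): this is MECH's
class-changing «ε₀» (at `q = 2` THE non-trivial `E¹`-class of `Sol_{2b}(1)`, «χ(N w) = −1»).  §B (datum-free): the Λ-direction flip `Λ ↦ ε • Λ` with a FREE flip predicate `P` — «SOME admissible ε has P» + «FACE: every admissible ε with P reverses the label» ⇒
half∕half (★ p860839 `…_labelReversing` ∕ `…_exchange`); per LH4-p09 (g9) 14:23:16Z this is the form both axis and tube cells take (the face decides `P`: `χ(N_ρ ε) = −1`).  §C: the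
admissible flip that EXISTS today — the `ω_{E∕F}`-flip of ★ `exists_flipUnit_of_forall_fixed_fixed_isNorm` (LH4-p11 (g5)); the tube cells' `χ(N_ρ ·)`-flip waits for the face's `χ`.
HONEST LABEL: count-neutral; the face, the cell list of record and (S4) are elsewhere; `HC_CM` is proved only modulo the 7 printed citations (2 remaining named inputs: hLiu418 =
`stmt-HodgeConjecture-24832`, h413 = `stmt-HodgeConjecture-24833`) until rung 0 closes.
References: [Serre1979] Ch. V §3 Prop. 5, Cor. 2–3; Ch. III §3 Prop. 7 · [Jacobowitz1962] §4 · [Rogawski1990] §4.9 Prop. 4.9.1 (b) p. 55 · [Kottwitz1986BaseChangeUnits] §1 pp. 240–241.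
-/

set_option autoImplicit false

namespace Summit.HodgeConjecture.HodgeConjecture.Cruxes.H413.F0P3cDyRamConeCellFlipUnits

open scoped Pointwise WithZero Valued
open WithZero
open Literature.NumberTheory.Automorphic.UnitaryThreeFourFrame (IsRamifiedQuadraticDatum)
open Literature.NumberTheory.LocalFields.WildQuadraticDatum
open Summit.HodgeConjecture.HodgeConjecture.Cruxes.H413.F0P3cDyRamToricCensusDefs
open Summit.HodgeConjecture.HodgeConjecture.Cruxes.H413.F0P3cDyRamConeCellFlipBalance
open Summit.HodgeConjecture.HodgeConjecture.Cruxes.H413.F0P3cDyRamConeWeightHalfSplit (exists_flipUnit_of_forall_fixed_fixed_isNorm)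

/-! ## §A  TUBE cells: the fibre symmetry with prescribed norm `η` exists (b ≥ d), preserves `Sol_{2b}(r)`, and changes the `E¹`-class when `|η − 1| = |ϖ|^{2b}` -/

section Tube

variable {K : Type} [Field K] [Valued K ℤᵐ⁰] {σ : K →+* K} {ϖ : K} {d t : ℕ}

/-- **PRESCRIBED-NORM UNIT ABOVE THE CONDUCTOR**: for `b ≥ d` and a `σ`-fixed `η` with `|η − 1| ≤ |ϖ|^{2b}` there is a unit `w ∈ 𝒪[K]` with `|w| = |σw| = 1` and `w·σw = η`
(★ deep norms at `n = 2b ≥ 2d − 1`; `|w|² = |η| = 1`). [cite: Serre1979, Ch. V §3 Prop. 5, Cor. 2–3] -/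
theorem exists_unit_mul_map_eq_of_fixed_level [CompleteSpace K] (hD : IsRamifiedQuadraticDatum σ ϖ d t) {b : ℕ} (hb : d ≤ b)
    {η : K} (hση : σ η = η) (hη : Valued.v (η - 1) ≤ Valued.v ϖ ^ (2 * b)) :
    ∃ w : (𝒪[K])ˣ, Valued.v ((w : 𝒪[K]) : K) = 1 ∧ Valued.v (σ ((w : 𝒪[K]) : K)) = 1 ∧ ((w : 𝒪[K]) : K) * σ ((w : 𝒪[K]) : K) = η := by
  have hvσ : ∀ a, Valued.v (σ a) = Valued.v a := hD.2.1
  have hϖ : Valued.v ϖ = exp (-1 : ℤ) := hD.2.2.1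
  have hd1 : 1 ≤ d := hD.2.2.2.2.2.1
  obtain ⟨z, hz⟩ := exists_mul_map_eq_of_fixed_of_v_sub_one_le_pred hD hση (n := 2 * b) (by omega) hη
  have hη1 : Valued.v η = 1 := by
    have hlt : Valued.v (η - 1) < 1 :=
      hη.trans_lt (by rw [v_varpi_pow hϖ, ← exp_zero, exp_lt_exp]; omega)
    have := Valuation.map_add_eq_of_lt_left Valued.v (x := (1 : K)) (y := η - 1) (by rwa [map_one])
    rw [map_one, add_sub_cancel] at this
    exact this
  have hz1 : Valued.v z = 1 := by
    have h : Valued.v z * Valued.v z = 1 := by nth_rw 2 [← hvσ z]; rw [← map_mul, hz, hη1]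
    rw [← pow_two] at h
    exact ((pow_eq_one_iff).1 h).resolve_right two_ne_zero
  have hzi : IsUnit (⟨z, hz1.le⟩ : 𝒪[K]) := Valuation.Integers.isUnit_of_one' (Valuation.integer.integers Valued.v) hz1
  refine ⟨hzi.unit, hz1, by rw [hvσ]; exact hz1, ?_⟩
  exact hz

/-- **FIBRE-PRESERVATION LETTER**: `|η − 1| ≤ |ϖ|^{2b}`, `|r| ≤ 1` ⇒ `|η·r − r| ≤ |ϖ^{2b}|` (the `hz` of ★ p860839 §2). [cite: Jacobowitz1962, §4] -/
theorem v_mul_sub_le_of_level {b : ℕ} {η r : K} (hη : Valued.v (η - 1) ≤ Valued.v ϖ ^ (2 * b)) (hr : Valued.v r ≤ 1) :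
    Valued.v (η * r - r) ≤ Valued.v (ϖ ^ (2 * b)) := by
  rw [show η * r - r = (η - 1) * r by ring, map_mul, map_pow]
  calc Valued.v (η - 1) * Valued.v r ≤ Valued.v ϖ ^ (2 * b) * 1 := by gcongr
    _ = Valued.v ϖ ^ (2 * b) := mul_one _

/-- **THE CLASS CHANGES** (MECH (M1)(M2)(M4)'s `ε₀`): under `|2| < 1`, if `w·σw = η` with `|η − 1| = |ϖ|^{2b}` EXACTLY (`b ≥ 1`), then `w ∉ E¹·(1 + 𝓂^{2b})`: there is NO `z` with `z·σz = 1`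
and `|w − z| ≤ |ϖ|^{2b}` — for `w = z(1+x)`, `|x| ≤ |ϖ|^{2b}`, gives `wσw − 1 = (x + σx) + xσx` of valuation `≤ |ϖ|^{2b+1}` (★ trace bound). [cite: Serre1979, Ch. III §3 Prop. 7; Ch. V §3] -/
theorem not_exists_normOne_near_of_norm_level_eq (hD : IsRamifiedQuadraticDatum σ ϖ d t) (h2 : Valued.v (2 : K) < 1) {b : ℕ} (hb : 1 ≤ b)
    {w η : K} (hw : w * σ w = η) (hη : Valued.v (η - 1) = Valued.v ϖ ^ (2 * b)) :
    ¬ ∃ z : K, z * σ z = 1 ∧ Valued.v (w - z) ≤ Valued.v ϖ ^ (2 * b) := by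
  rintro ⟨z, hz1, hwz⟩
  have hvσ : ∀ a, Valued.v (σ a) = Valued.v a := hD.2.1
  have hϖ : Valued.v ϖ = exp (-1 : ℤ) := hD.2.2.1
  have hTr := trace_bound_of_isRamifiedQuadraticDatum hD h2
  have hvz : Valued.v z = 1 := by
    have h : Valued.v z * Valued.v z = 1 := by nth_rw 2 [← hvσ z]; rw [← map_mul, hz1, map_one]
    rw [← pow_two] at h
    exact ((pow_eq_one_iff).1 h).resolve_right two_ne_zero
  have hz0 : z ≠ 0 := fun h0 => by rw [h0, map_zero] at hvz; exact zero_ne_one hvz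
  -- `x := (w − z)∕z`, `w = z(1 + x)`
  set x : K := (w - z) / z with hxdef
  have hxv : Valued.v x ≤ Valued.v ϖ ^ (2 * b) := by rw [hxdef, map_div₀, hvz, div_one]; exact hwz
  have hwx : w = z * (1 + x) := by rw [hxdef]; field_simp; ring
  have hN : η - 1 = (x + σ x) + x * σ x := by
    rw [← hw, hwx, map_mul, map_add, map_one]
    linear_combination (1 + x) * (1 + σ x) * hz1
  have hpow : ∀ n : ℕ, Valued.v ϖ ^ n = exp (-(n : ℤ)) := v_varpi_pow hϖ
  have h1 : Valued.v (x + σ x) ≤ Valued.v ϖ ^ (2 * b + 1) :=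
    (hTr x).trans (by rw [pow_succ, mul_comm]; gcongr)
  have h2' : Valued.v (x * σ x) ≤ Valued.v ϖ ^ (2 * b + 1) := by
    rw [map_mul, hvσ]
    calc Valued.v x * Valued.v x ≤ Valued.v ϖ ^ (2 * b) * Valued.v ϖ ^ (2 * b) := by gcongr
      _ ≤ Valued.v ϖ ^ (2 * b + 1) := by rw [← pow_add, hpow, hpow, exp_le_exp]; omega
  have hle : Valued.v (η - 1) ≤ Valued.v ϖ ^ (2 * b + 1) := by rw [hN]; exact (Valuation.map_add _ _ _).trans (max_le h1 h2')
  rw [hη, hpow, hpow, exp_le_exp] at hle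
  omega

/-- **THE NON-TRIVIAL CLASS IS POPULATED**: `η₀ := 1 + (ϖσϖ)^b` is `σ`-fixed with `|η₀ − 1| = |ϖ|^{2b}` exactly (so §A's unit for `η₀` is class-changing by
`not_exists_normOne_near_of_norm_level_eq`). [cite: Serre1979, Ch. V §3] -/
theorem exists_fixed_level_eq (hD : IsRamifiedQuadraticDatum σ ϖ d t) (b : ℕ) :
    ∃ η : K, σ η = η ∧ Valued.v (η - 1) = Valued.v ϖ ^ (2 * b) := by
  have hσ : ∀ a, σ (σ a) = a := hD.1
  have hvσ : ∀ a, Valued.v (σ a) = Valued.v a := hD.2.1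
  refine ⟨1 + (ϖ * σ ϖ) ^ b, by rw [map_add, map_one, map_pow, map_mul, hσ, mul_comm], ?_⟩
  rw [add_sub_cancel_left, map_pow, map_mul, hvσ, ← pow_two, ← pow_mul, mul_comm]

end Tube

/-! ## §B  The Λ-direction flip `Λ ↦ ε • Λ` with a FREE flip predicate `P` (LH4-p09 (g9) 14:23:16Z: WHICH `ε` reverses the label is the face's decision —
`χ(N_ρ ε) = −1` for the face's character `χ` —; the composition only needs SOME admissible `ε` with `P ε`, and the face for all of them).  Datum-free. -/

section Face

variable {K : Type*} [Field K] [Valued K ℤᵐ⁰] {ρ Θ : K →+* K} {α : K}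

/-- **«SPECIFIC CELL BALANCED, GIVEN THE FACE»** (axis AND tube cells, Λ-direction; ★ p860839 `ncard_levelSetDep_sep_eq_of_flip_labelReversing`): if SOME admissible flip
(`ε·Θε = ξ`, `ρξ = ξ`, `|ξ| = 1` — cell-preserving by ★ p860839 §1) satisfies the face's predicate `P`, and the FACE says every admissible `ε` with `P ε` reverses the label on the
cell, then the cell is half∕half. [cite: Rogawski1990, §4.9 Prop. 4.9.1 (b) p. 55] [cite: Kottwitz1986BaseChangeUnits, §1 pp. 240–241] -/
theorem ncard_levelSetDep_sep_eq_of_face (P : K → Prop) (hP : ∃ ε ξ : K, P ε ∧ ε * Θ ε = ξ ∧ ρ ξ = ξ ∧ Valued.v ξ = 1)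
    (ϖE h : K) (j a : ℕ) (μ : K) (lab : AddSubgroup K → Prop)
    (hface : ∀ ε ξ : K, P ε → ε * Θ ε = ξ → ρ ξ = ξ → Valued.v ξ = 1 → ∀ Λ ∈ levelSetDep ρ Θ α ϖE h j a μ, lab (ε • Λ) ↔ ¬ lab Λ) :
    {Λ ∈ levelSetDep ρ Θ α ϖE h j a μ | lab Λ}.ncard = {Λ ∈ levelSetDep ρ Θ α ϖE h j a μ | ¬ lab Λ}.ncard := by
  obtain ⟨ε, ξ, hPε, hε, hρξ, hξ1⟩ := hP
  exact ncard_levelSetDep_sep_eq_of_flip_labelReversing hε hρξ hξ1 ϖE h j a μ lab (hface ε ξ hPε hε hρξ hξ1)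

/-- **TWO-LABEL FORM** (`P₁ Λ → Q₁ (ε • Λ)`, `Q₁ Λ → P₁ (ε⁻¹ • Λ)` for every admissible `ε` with `P ε` ⇒ `#{P₁} = #{Q₁}`; ★ `ncard_levelSetDep_sep_eq_of_flip_exchange`).
[cite: Rogawski1990, §4.9 Prop. 4.9.1 (b) p. 55] -/
theorem ncard_levelSetDep_sep_eq_of_face_exchange (P : K → Prop) (hP : ∃ ε ξ : K, P ε ∧ ε * Θ ε = ξ ∧ ρ ξ = ξ ∧ Valued.v ξ = 1)
    (ϖE h : K) (j a : ℕ) (μ : K) (P₁ Q₁ : AddSubgroup K → Prop)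
    (hface : ∀ ε ξ : K, P ε → ε * Θ ε = ξ → ρ ξ = ξ → Valued.v ξ = 1 →
      (∀ Λ ∈ levelSetDep ρ Θ α ϖE h j a μ, P₁ Λ → Q₁ (ε • Λ)) ∧ (∀ Λ ∈ levelSetDep ρ Θ α ϖE h j a μ, Q₁ Λ → P₁ (ε⁻¹ • Λ))) :
    {Λ ∈ levelSetDep ρ Θ α ϖE h j a μ | P₁ Λ}.ncard = {Λ ∈ levelSetDep ρ Θ α ϖE h j a μ | Q₁ Λ}.ncard := by
  obtain ⟨ε, ξ, hPε, hε, hρξ, hξ1⟩ := hP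
  obtain ⟨hPQ, hQP⟩ := hface ε ξ hPε hε hρξ hξ1
  exact ncard_levelSetDep_sep_eq_of_flip_exchange hε hρξ hξ1 ϖE h j a μ P₁ Q₁ hPQ hQP

end Face

/-! ## §C  The admissible flip that EXISTS today: the `ω_{E∕F}`-flip of ★ `ConeWeightHalfSplit` (MECH (M3); axis cells, where by LH4-p09's reading the face's character must still be
CHECKED to agree with `ω_{E∕F}∘N_Θ`; the tube cells' populatedness-preserving `χ(N_ρ ·)`-flip — `ξ` a norm from `E` — waits for the face's `χ` (F0P3-p01 CHI-PROBE)) -/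

section OmegaFlip

variable {E : Type} {M : Type*} [Field E] [Valued E ℤᵐ⁰] [Field M] [Valued M ℤᵐ⁰] {ρ Θ : M →+* M}

/-- **THE `ω`-FLIP IS ADMISSIBLE AND EXISTS** (§B's `hP` for `P ε :↔ ∃ ξ₀, ε·Θε = jE ξ₀ ∧ σξ₀ = ξ₀ ∧ ξ₀ ∉ N(E)`): from ★ `exists_flipUnit_of_forall_fixed_fixed_isNorm` (tower letters,
`hFN`); `ρ(jE ξ₀) = jE ξ₀` by `hjfix`, `|jE ξ₀| = |ε|·|Θε| = 1`. [cite: Serre1979, Ch. V §3 Cor. 3] [cite: Kottwitz1986BaseChangeUnits, §1 pp. 240–241] -/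
theorem exists_omegaFlip_admissible [CompleteSpace E] [Finite 𝓀[E]]
    (σ : E →+* E) {ϖ : E} {d t : ℕ} (hD : IsRamifiedQuadraticDatum σ ϖ d t) (jE : E →+* M)
    (hvΘ : ∀ x, Valued.v (Θ x) = Valued.v x) (hΘj : ∀ x, Θ (jE x) = jE (σ x)) (hjfix : ∀ z, ρ z = z ↔ ∃ c, jE c = z)
    (hjpow : ∀ (t : E) (n : ℤ), Valued.v (jE t) = Valued.v (jE ϖ) ^ n ↔ Valued.v t = Valued.v ϖ ^ n)
    (hFN : ∀ f : M, ρ f = f → Θ f = f → Valued.v f = 1 → ∃ z : M, z * Θ z = f) :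
    ∃ ε ξ : M, (∃ ξ₀ : E, ε * Θ ε = jE ξ₀ ∧ σ ξ₀ = ξ₀ ∧ ¬ ∃ e : E, e * σ e = ξ₀) ∧ ε * Θ ε = ξ ∧ ρ ξ = ξ ∧ Valued.v ξ = 1 := by
  obtain ⟨z, ξ₀, hz1, hzξ, hσξ, hξN⟩ := exists_flipUnit_of_forall_fixed_fixed_isNorm σ hD jE hvΘ hΘj hjfix hjpow hFN
  have hρξ : ρ (jE ξ₀) = jE ξ₀ := (hjfix _).2 ⟨ξ₀, rfl⟩
  have hξ1 : Valued.v (jE ξ₀) = 1 := by rw [← hzξ, map_mul, hvΘ, hz1, mul_one]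
  exact ⟨z, jE ξ₀, ⟨ξ₀, hzξ, hσξ, hξN⟩, hzξ, hρξ, hξ1⟩

/-- **«SPECIFIC CELL BALANCED, GIVEN THE `ω`-FACE»** (§B at the `ω`-flip; MECH (M3) axis cells): if every `ε` with `ε·Θε = jE ξ₀`, `ξ₀` a `σ`-fixed non-norm, reverses the label
on the cell, the cell is half∕half — the flip exists by `exists_omegaFlip_admissible`. [cite: Serre1979, Ch. V §3 Cor. 3] [cite: Rogawski1990, §4.9 Prop. 4.9.1 (b) p. 55] -/
theorem ncard_levelSetDep_sep_eq_of_omegaFace [CompleteSpace E] [Finite 𝓀[E]]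
    (σ : E →+* E) {ϖ : E} {d t : ℕ} (hD : IsRamifiedQuadraticDatum σ ϖ d t) (jE : E →+* M)
    (hvΘ : ∀ x, Valued.v (Θ x) = Valued.v x) (hΘj : ∀ x, Θ (jE x) = jE (σ x)) (hjfix : ∀ z, ρ z = z ↔ ∃ c, jE c = z)
    (hjpow : ∀ (t : E) (n : ℤ), Valued.v (jE t) = Valued.v (jE ϖ) ^ n ↔ Valued.v t = Valued.v ϖ ^ n)
    (hFN : ∀ f : M, ρ f = f → Θ f = f → Valued.v f = 1 → ∃ z : M, z * Θ z = f)
    (α ϖE h : M) (j a : ℕ) (μ : M) (lab : AddSubgroup M → Prop)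
    (hface : ∀ (ε : M) (ξ₀ : E), ε * Θ ε = jE ξ₀ → σ ξ₀ = ξ₀ → (¬ ∃ e : E, e * σ e = ξ₀) → ∀ Λ ∈ levelSetDep ρ Θ α ϖE h j a μ, lab (ε • Λ) ↔ ¬ lab Λ) :
    {Λ ∈ levelSetDep ρ Θ α ϖE h j a μ | lab Λ}.ncard = {Λ ∈ levelSetDep ρ Θ α ϖE h j a μ | ¬ lab Λ}.ncard :=
  ncard_levelSetDep_sep_eq_of_face (α := α) (fun ε => ∃ ξ₀ : E, ε * Θ ε = jE ξ₀ ∧ σ ξ₀ = ξ₀ ∧ ¬ ∃ e : E, e * σ e = ξ₀)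
    (exists_omegaFlip_admissible σ hD jE hvΘ hΘj hjfix hjpow hFN) ϖE h j a μ lab
    (fun ε _ ⟨ξ₀, hε, hσξ, hξN⟩ _ _ _ => hface ε ξ₀ hε hσξ hξN)

end OmegaFlip

end Summit.HodgeConjecture.HodgeConjecture.Cruxes.H413.F0P3cDyRamConeCellFlipUnits
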